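import Summits.ResolutionOfSingularities.ResolutionOfSingularities.Theorems.MarkedTransferCampaignW36SupplyLemmas
import Literature.AlgebraicGeometry.Hironaka2017.Lib.DiffPowerCompleteIntersection
import HarnessLib

/-!
# [L1 W3.6 · D-lane kernel] The supply lemma T-A HOLDS: `CampaignW36.OrdPowOfLCICutOn A` for every ambient datum and
# `OrdPowOfLCICut_ours p` for every `p` — hence the A-type half of the W3.6 door is binder-free

Cell `res-hironaka`, HIRONAKA-L discharge lane (seat res-D-pv-025) serving rung L slot W3.6 (director-resolution g3 DOOR OF RECORD
2026-08-27T02:23:55Z; typed by res-L1-type-o4 in `…Theorems/MarkedTransferCampaignW36SupplyLemmas.lean` p488503; director 02:54:48Z: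
«res-D-pv-025 (T-A kernel, no duplication by s36)»). HONEST FRAMING (D-0012/D-0089): every declaration below is a KERNEL THEOREM about
OUR typed objects (res-type-010's order-defined `S06BaseHike.diffPower`, o4's class predicate `CampaignW36.IsLCICutAt`); nothing printed
in [Hironaka2017] is asserted and the manuscript stays «under review». AI-produced kernel proof; weaker than expert review of the surrounding
programme, but the statements below are closed theorems with standard axioms.

THE KERNEL (tree, this seat): `Literature/AlgebraicGeometry/Resolution/SymbolicPowersRegularSequence.lean` (p489531) — the powers of a
RADICAL ideal generated by a (weakly) REGULAR SEQUENCE are unmixed (`IsQuasiRegular.mem_pow_of_forall_minimalPrimes`, Rees' form of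
Matsumura Thm. 16.2; no Cohen–Macaulay / irreducibility / Noetherian hypothesis), whence on ANY scheme an ideal sheaf of order `≥ μ` at every
point of an everywhere-l.c.i. closed `Y` lies in `𝓘_Y^μ` (`le_vanishingIdeal_pow_of_forall_le_idealOrder_of_isRegular`); and
`Literature/AlgebraicGeometry/Hironaka2017/Lib/DiffPowerCompleteIntersection.lean` (p489849) — `S06BaseHike.diffPower_le_pow_of_isRegular` /
`diffPower_eq_pow_of_isRegular`: `𝓘_C^{⟨b⟩} = 𝓘_C^b` for such `C`, every scheme, every `b`.

CONTENTS: `CampaignW36.ordPowOfLCICutOn_holds` (T-A per ambient datum — in fact with no use of the ambient structure),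
`ordPowOfLCICut_ours_holds` (the director's `p`-slice), and the binder-free forms of o4's one-screen compositions that took T-A as a
hypothesis: `CampaignW36.hatStableTowerLEOn_lci` (⟨StableTower b₀ ≤ 1⟩ on the A-type class), `CampaignW36.coreFocusExistsOn_lci_of_hatUscCutOn`
(⟨UscCut⟩|A ⇒ `CoreFocusExistsOn LCIClass`, i.e. «`U30_2_R2_inst`|A-type» modulo the W3.1 slot statement only),
`campaignW36HatStableTowerLEOnI_lci`, `campaignW36CoreFocusExists_lci_of_usc` (`p`-slices). PLACEMENT (res-lit-2 PLACEMENT-W36 v1.0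
03:01:18Z): T-A = routine corollary of Zariski–Samuel II App. 6 Lemma 5 / Matsumura Ex. 17.4 — consistent with the kernel route used.
-/

noncomputable section

set_option linter.dupNamespace false -- mandated namespace of this single-conjunct summit

open _root_.AlgebraicGeometry _root_.TopologicalSpace _root_.CategoryTheory

namespace Summit.ResolutionOfSingularities.ResolutionOfSingularities.Theorems

open Literature.AlgebraicGeometry.Resolution
open Literature.AlgebraicGeometry.Hironaka2017
open Literature.AlgebraicGeometry.Hironaka2017.S02Preliminaries
open Literature.AlgebraicGeometry.Hironaka2017.S04CharAlgebra
open Literature.AlgebraicGeometry.Hironaka2017.S06BaseHike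
open Literature.AlgebraicGeometry.Hironaka2017.Datum

universe u

namespace CampaignW36

variable {p : ℕ} [Fact p.Prime] {K : Type u} [Field K] [CharP K p]

/-- **T-A HOLDS: `CampaignW36.OrdPowOfLCICutOn A` for every ambient datum `A`** — for every closed `C ⊆ A.Z` that is A-type
(`IsLCICutAt C x`: `(𝓘_C)_x` generated by a regular sequence) at every point of `C` and every `b` (the typed `0 < b` is not needed),
`diffPower C b ≤ 𝓘_C^b`: the tree theorem `S06BaseHike.diffPower_le_pow_of_isRegular` (any scheme). Kernel: powers of a radical ideal
generated by a regular sequence are unmixed (Matsumura Thm. 16.2 in Rees' form; Zariski–Samuel II App. 6 Lemma 5). NOT a statement of the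
manuscript. [cite: Matsumura1987, Thm. 16.2] [cite: ZariskiSamuel1960, Vol. II App. 6 Lemma 5] -/
theorem ordPowOfLCICutOn_holds (A : AmbientDatum p K) : OrdPowOfLCICutOn A :=
  fun C hC b _ => diffPower_le_pow_of_isRegular C hC b

variable {IsEdgeData : ∀ ⦃X : Scheme.{u}⦄ ⦃p n : ℕ⦄ (E : IdealExponent X) (ξ : X), EdgeDatumAt p n E ξ → Prop}
variable [PerfectField K] {A : AmbientDatum p K} {n : ℕ}

/-- **⟨StableTower `b₀ ≤ 1`⟩ on the A-type class, BINDER-FREE** — o4's `hatStableTowerLEOn_lci_of_ordPowOfLCICutOn` with its T-A hypothesis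
discharged by `ordPowOfLCICutOn_holds`. NOT a statement of the manuscript. [cite: Matsumura1987, Thm. 16.2] -/
theorem hatStableTowerLEOn_lci : HatStableTowerLEOn LCIClass IsEdgeData 1 A n :=
  hatStableTowerLEOn_lci_of_ordPowOfLCICutOn (ordPowOfLCICutOn_holds A)

/-- **«`U30_2_R2_inst`|A-type» modulo the W3.1 slot statement ONLY** — o4's `coreFocusExistsOn_lci_of_ordPowOfLCICutOn` with T-A
discharged: ⟨UscCut⟩ on the A-type class ⇒ `CoreFocusExistsOn LCIClass` (`Ě = cutDown Ê Σ̄_max`). NOT a statement of the manuscript.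
[cite: Matsumura1987, Thm. 16.2] -/
theorem coreFocusExistsOn_lci_of_hatUscCutOn (hU : HatUscCutOn LCIClass IsEdgeData A n) :
    CoreFocusExistsOn LCIClass IsEdgeData A n :=
  coreFocusExistsOn_lci_of_ordPowOfLCICutOn hU (ordPowOfLCICutOn_holds A)

/-- **«`U30_2_R2_inst`|A-type» from the W3.1 statement `CampaignW31InvmaxClosed`** — o4's `coreFocusExistsOn_lci_of_invmaxClosed` with T-A
discharged. NOT a statement of the manuscript. [cite: Matsumura1987, Thm. 16.2] -/
theorem coreFocusExistsOn_lci_of_invmaxClosed' (hW31 : CampaignW31InvmaxClosed.{u} IsEdgeData) :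
    CoreFocusExistsOn LCIClass IsEdgeData A n :=
  coreFocusExistsOn_lci_of_invmaxClosed hW31 (ordPowOfLCICutOn_holds A)

end CampaignW36

open CampaignW36

/-- **T-A, the director's `p`-slice, HOLDS: `OrdPowOfLCICut_ours p`** for every prime `p` (indeed with no use of `p`, of perfectness or of
the ambient structure: the content is `S06BaseHike.diffPower_le_pow_of_isRegular` on any scheme). So `stub_TA` of the W3.6 skeleton is a
theorem, not a premise. NOT a statement of the manuscript. [cite: Matsumura1987, Thm. 16.2] [cite: ZariskiSamuel1960, Vol. II App. 6 Lemma 5] -/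
theorem ordPowOfLCICut_ours_holds (p : ℕ) [Fact p.Prime] : OrdPowOfLCICut_ours.{u} p :=
  fun _K _ _ _ A => ordPowOfLCICutOn_holds A

/-- **The level-1 ⟨StableTower⟩ target on the A-type class, BINDER-FREE `p`-slice**: `CampaignW36HatStableTowerLEOnI LCIClass 1 p`
(o4's `campaignW36HatStableTowerLEOnI_lci_of_ordPow` ∘ `ordPowOfLCICut_ours_holds`). NOT a statement of the manuscript.
[cite: Matsumura1987, Thm. 16.2] -/
theorem campaignW36HatStableTowerLEOnI_lci (p : ℕ) [Fact p.Prime] : CampaignW36HatStableTowerLEOnI.{u} LCIClass 1 p :=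
  campaignW36HatStableTowerLEOnI_lci_of_ordPow p (ordPowOfLCICut_ours_holds p)

/-- **«`U30_2_R2_inst`|A-type» `p`-slice modulo the W3.1 slot statement ONLY**: `CampaignW31UscInvOneExponentI p ⇒
CampaignW36CoreFocusExistsOnI LCIClass p` (o4's `campaignW36CoreFocusExists_lci_of_usc_of_ordPow` with T-A discharged). NOT a statement
of the manuscript. [cite: Matsumura1987, Thm. 16.2] -/
theorem campaignW36CoreFocusExists_lci_of_usc (p : ℕ) [Fact p.Prime] (h₁ : CampaignW31UscInvOneExponentI.{u} p) :
    CampaignW36CoreFocusExistsOnI.{u} LCIClass p :=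
  campaignW36CoreFocusExists_lci_of_usc_of_ordPow p h₁ (ordPowOfLCICut_ours_holds p)

end Summit.ResolutionOfSingularities.ResolutionOfSingularities.Theorems

end
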